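import Literature.Computability.Complexity.HardcoreInapproximabilitySecondMomentQB
import Literature.Computability.Complexity.HardcoreInapproximabilitySecondMomentAcoef
import Literature.Computability.Complexity.HardcoreInapproximabilitySecondMomentWindow
import HarnessLib

/-!
# The limiting constant of the second-moment ratio: `τ = (1-(d-1)²ρ²)^{-1/2} (1-ρ²)^{-(d-1)/2}`

The planar form `S = Q₀ + d M_B` (`slySA, slySB, slySC`, `slyS_eq`), its determinant
(`slyS_det`), the prefactors at the product point (`slyPrefB_cstar_eq`, `exp_slyPrefB_cstar`,
`slyPrefA_cstar_eq`, `exp_slyPrefA_cstar`) and the identities `e^{Pref_B(c*)}(1-ρ²) = κ₃`,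
`e^{Pref_A(c*)}(1-(d-1)²ρ²) = (1-ρ²)(AC-B²)` (`exp_slyPrefB_mul`, `exp_slyPrefA_mul`); positive
definiteness and size of `S` from `-H_d ≻ κ` (`slyS_bounds`); and the evaluation of the Laplace
constant `e^{Pref_A/2}(e^{Pref_B/2}κ₃^{-1/2})^d/√(AC-B²) = τ` (`slyTau`, `slyTau_eq_prefactors`),
`τ = exp(Σ_i λ_i δ_i²)` being Mossel–Weitz–Wormald's limit of `E[Z²]/(EZ)²`.

## References
* [MosselWeitzWormald2008] E. Mossel, D. Weitz, N. Wormald, PTRF 143 (2009), Theorem 6.11, Lemma 7.6.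
* [Sly2010] A. Sly, FOCS 2010 / arXiv:1005.5584, Lemma 3.5, Lemma 3.9.
-/

namespace Literature.Computability.Complexity

open Real Finset

section Planar

variable (d : ℕ) (α β : ℝ)

/-- Entry `A` of the planar form `-2 S`, `S(h₁,h₂) = Q₀(h₁,h₂) + d M_B(h₁,h₂) = max_{h₃} Q_d(h)`
(the Schur complement of `-H_f`). [cite: MosselWeitzWormald2008, proof of Theorem 6.11 (the second Gaussian integration)] -/
noncomputable def slySA : ℝ :=
  -((α - 2) / (α * (α - 1) ^ 2) - 1 / α ^ 2 + d * (slyB13 α β ^ 2 / slyK3 α β + slyB11 α β))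

/-- Entry `B` of the planar form `-2 S`. [cite: MosselWeitzWormald2008, proof of Theorem 6.11] -/
noncomputable def slySB : ℝ := -(d * (slyB13 α β * slyB23 α β / slyK3 α β + slyB23 α β))

/-- Entry `C` of the planar form `-2 S`. [cite: MosselWeitzWormald2008, proof of Theorem 6.11] -/
noncomputable def slySC : ℝ := -(-1 / (β ^ 2 * (1 - β) ^ 2) + d * (slyB23 α β ^ 2 / slyK3 α β + slyB22 α β))

/-- **Sly's/MWW's limiting second-moment ratio** `τ = (1-(d-1)²ρ²)^{-1/2} (1-ρ²)^{-(d-1)/2}`,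
`ρ = αβ/((1-α)(1-β))` (`= exp(Σ_i λ_i δ_i²)` over even cycle lengths).
[cite: MosselWeitzWormald2008, Theorem 6.11 and Lemma 7.6; Sly2010, Lemma 3.9] -/
noncomputable def slyTau : ℝ :=
  (1 - ((d : ℝ) - 1) ^ 2 * (α * β / ((1 - α) * (1 - β))) ^ 2) ^ (-(1 / 2 : ℝ)) *
    (1 - (α * β / ((1 - α) * (1 - β))) ^ 2) ^ (-(((d : ℝ) - 1) / 2))

variable {d α β}

set_option maxHeartbeats 4000000 in
/-- **`S = Q₀ + d M_B` in coordinates.** [folklore] -/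
theorem slyS_eq (hα : 0 < α) (hβ : 0 < β) (hαβ : α + β < 1) (h₁ h₂ : ℝ) :
    slyQ 0 α β h₁ h₂ 0 + d * slyMB α β h₁ h₂ =
      -(slySA d α β * h₁ ^ 2 + 2 * slySB d α β * h₁ * h₂ + slySC d α β * h₂ ^ 2) / 2 := by
  have h1 : (1 - α) ≠ 0 := by intro h; linarith
  have h1' : (α - 1) ≠ 0 := by intro h; linarith
  have h2 : (1 - β) ≠ 0 := by intro h; linarith
  have h3 : (1 - α - β) ≠ 0 := by intro h; linarith
  have hα' : α ≠ 0 := hα.ne'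
  have hβ' : β ≠ 0 := hβ.ne'
  have hK := (slyK3_pos hα hβ hαβ).ne'
  unfold slyMB slySA slySB slySC
  unfold slyQ
  push_cast
  field_simp
  ring

set_option maxHeartbeats 4000000 in
/-- **The determinant of the planar form** (`= det(-H_f)/(-h₃₃)`):
`AC - B² = (1-α-β+dαβ)((1-α)(1-β)-(d-1)αβ) / (α²β²(1-α)²(1-β)²(1-α-β)(1-α-β+2αβ))`.
[cite: MosselWeitzWormald2008, proof of Theorem 6.11] -/
theorem slyS_det (hα : 0 < α) (hβ : 0 < β) (hαβ : α + β < 1) :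
    slySA d α β * slySC d α β - slySB d α β ^ 2 =
      (1 - α - β + d * α * β) * ((1 - α) * (1 - β) - ((d : ℝ) - 1) * α * β) /
        (α ^ 2 * β ^ 2 * (1 - α) ^ 2 * (1 - β) ^ 2 * (1 - α - β) * (1 - α - β + 2 * α * β)) := by
  have h1 : (1 - α) ≠ 0 := by intro h; linarith
  have h1' : (α - 1) ≠ 0 := by intro h; linarith
  have h2 : (1 - β) ≠ 0 := by intro h; linarith
  have h3 : (1 - α - β) ≠ 0 := by intro h; linarith
  have hα' : α ≠ 0 := hα.ne'
  have hβ' : β ≠ 0 := hβ.ne'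
  have h4 : (1 - α - β + 2 * α * β) ≠ 0 := by
    have : 0 < 1 - α - β + 2 * α * β := by nlinarith
    exact this.ne'
  have hKi : (slyK3 α β)⁻¹ = α * β * (1 - α) * (1 - β) * (1 - α - β) / (1 - α - β + 2 * α * β) := by
    unfold slyK3; rw [inv_div]
  unfold slySA slySB slySC
  simp only [div_eq_mul_inv _ (slyK3 α β), hKi]
  unfold slyB13 slyB23 slyB11 slyB22
  set u := 1 - α - β + 2 * α * β with hu
  field_simp
  rw [hu]
  ring

end Planar

section Prefactors

variable {α β : ℝ}

/-- **The colour prefactor at the product point, as logarithms**: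
`Pref_B(c*) = log(1-α) + log(1-β) - log α - log β - 2 log(1-α-β)`. [folklore] -/
theorem slyPrefB_cstar_eq (hα : 0 < α) (hβ : 0 < β) (hαβ : α + β < 1) :
    slyPrefB α β (α ^ 2) (β ^ 2) (α * (1 - α - β)) =
      Real.log (1 - α) + Real.log (1 - β) - Real.log α - Real.log β - 2 * Real.log (1 - α - β) := by
  have h1 : 0 < 1 - α := by linarith
  have h2 : 0 < 1 - β := by linarith
  have h3 : 0 < 1 - α - β := by linarith
  have h4 : 0 < 1 - β + α := by linarith
  have h5 : 0 < 1 + α := by linarith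
  -- factorisations of the compound arguments
  have e1 : Real.log (1 - 2 * β + β ^ 2) = 2 * Real.log (1 - β) := by
    rw [show (1:ℝ) - 2 * β + β ^ 2 = (1 - β) ^ 2 by ring, Real.log_pow]; norm_num
  have e2 : Real.log (α ^ 2) = 2 * Real.log α := by rw [Real.log_pow]; norm_num
  have e3 : Real.log (1 - 2 * β + β ^ 2 - α ^ 2) = Real.log (1 - α - β) + Real.log (1 - β + α) := by
    rw [show (1:ℝ) - 2 * β + β ^ 2 - α ^ 2 = (1 - α - β) * (1 - β + α) by ring,
      Real.log_mul h3.ne' h4.ne']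
  have e4 : Real.log (α * (1 - α - β)) = Real.log α + Real.log (1 - α - β) :=
    Real.log_mul hα.ne' h3.ne'
  have e5 : Real.log (1 - 2 * β + β ^ 2 - α ^ 2 - α * (1 - α - β)) =
      Real.log (1 - α - β) + Real.log (1 - β) := by
    rw [show (1:ℝ) - 2 * β + β ^ 2 - α ^ 2 - α * (1 - α - β) = (1 - α - β) * (1 - β) by ring,
      Real.log_mul h3.ne' h2.ne']
  have e6 : Real.log (β - β ^ 2) = Real.log β + Real.log (1 - β) := by
    rw [show β - β ^ 2 = β * (1 - β) by ring, Real.log_mul hβ.ne' h2.ne']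
  have e7 : Real.log (α - α ^ 2 - α * (1 - α - β)) = Real.log α + Real.log β := by
    rw [show α - α ^ 2 - α * (1 - α - β) = α * β by ring, Real.log_mul hα.ne' hβ.ne']
  have e8 : Real.log (β - β ^ 2 - (α - α ^ 2 - α * (1 - α - β))) = Real.log β + Real.log (1 - α - β) := by
    rw [show β - β ^ 2 - (α - α ^ 2 - α * (1 - α - β)) = β * (1 - α - β) by ring,
      Real.log_mul hβ.ne' h3.ne']
  have e9 : Real.log (1 - β - α ^ 2 - α * (1 - α - β)) = Real.log (1 - α) + Real.log (1 - β) := by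
    rw [show (1:ℝ) - β - α ^ 2 - α * (1 - α - β) = (1 - α) * (1 - β) by ring,
      Real.log_mul h1.ne' h2.ne']
  have e10 : Real.log (α - α ^ 2) = Real.log α + Real.log (1 - α) := by
    rw [show α - α ^ 2 = α * (1 - α) by ring, Real.log_mul hα.ne' h1.ne']
  have e11 : Real.log (1 - β - α ^ 2 - α * (1 - α - β) - (α - α ^ 2)) =
      Real.log (1 - α) + Real.log (1 - α - β) := by
    rw [show (1:ℝ) - β - α ^ 2 - α * (1 - α - β) - (α - α ^ 2) = (1 - α) * (1 - α - β) by ring,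
      Real.log_mul h1.ne' h3.ne']
  have e12 : Real.log (1 - α ^ 2) = Real.log (1 - α) + Real.log (1 + α) := by
    rw [show (1:ℝ) - α ^ 2 = (1 - α) * (1 + α) by ring, Real.log_mul h1.ne' h5.ne']
  have e13 : Real.log (1 - α ^ 2 - (α - α ^ 2)) = Real.log (1 - α) := by
    rw [show (1:ℝ) - α ^ 2 - (α - α ^ 2) = 1 - α by ring]
  have e14 : Real.log (1 - α - (α - α ^ 2)) = 2 * Real.log (1 - α) := by
    rw [show (1:ℝ) - α - (α - α ^ 2) = (1 - α) ^ 2 by ring, Real.log_pow]; norm_num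
  have e15 : Real.log (1 - β - α) = Real.log (1 - α - β) := by
    rw [show (1:ℝ) - β - α = 1 - α - β by ring]
  unfold slyPrefB
  rw [e1, e2, e3, e4, e5, e6, e7, e8, e9, e10, e11, e12, e13, e14, e15, Real.log_one]
  ring

/-- **The colour prefactor at the product point**: `exp(Pref_B(c*)) = (1-α)(1-β)/(αβ(1-α-β)²)`.
[folklore] -/
theorem exp_slyPrefB_cstar (hα : 0 < α) (hβ : 0 < β) (hαβ : α + β < 1) :
    Real.exp (slyPrefB α β (α ^ 2) (β ^ 2) (α * (1 - α - β))) =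
      (1 - α) * (1 - β) / (α * β * (1 - α - β) ^ 2) := by
  have h1 : 0 < 1 - α := by linarith
  have h2 : 0 < 1 - β := by linarith
  have h3 : 0 < 1 - α - β := by linarith
  rw [slyPrefB_cstar_eq hα hβ hαβ,
    show (2:ℝ) * Real.log (1 - α - β) = Real.log ((1 - α - β) ^ 2) by rw [Real.log_pow]; norm_num]
  rw [Real.exp_sub, Real.exp_sub, Real.exp_sub, Real.exp_add, Real.exp_log h1, Real.exp_log h2,
    Real.exp_log hα, Real.exp_log hβ, Real.exp_log (by positivity)]
  field_simp

/-- **The overlap prefactor at the product point, as logarithms**: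
`Pref_A(c*) = -2(log α + log β + log(1-α) + log(1-β))`. [folklore] -/
theorem slyPrefA_cstar_eq (hα : 0 < α) (hβ : 0 < β) (hαβ : α + β < 1) :
    slyPrefA α β (α ^ 2) (β ^ 2) =
      -2 * (Real.log α + Real.log β + Real.log (1 - α) + Real.log (1 - β)) := by
  have h1 : 0 < 1 - α := by linarith
  have h2 : 0 < 1 - β := by linarith
  have e2 : Real.log (α ^ 2) = 2 * Real.log α := by rw [Real.log_pow]; norm_num
  have e10 : Real.log (α - α ^ 2) = Real.log α + Real.log (1 - α) := by
    rw [show α - α ^ 2 = α * (1 - α) by ring, Real.log_mul hα.ne' h1.ne']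
  have e14 : Real.log (1 - α - (α - α ^ 2)) = 2 * Real.log (1 - α) := by
    rw [show (1:ℝ) - α - (α - α ^ 2) = (1 - α) ^ 2 by ring, Real.log_pow]; norm_num
  have f2 : Real.log (β ^ 2) = 2 * Real.log β := by rw [Real.log_pow]; norm_num
  have f10 : Real.log (β - β ^ 2) = Real.log β + Real.log (1 - β) := by
    rw [show β - β ^ 2 = β * (1 - β) by ring, Real.log_mul hβ.ne' h2.ne']
  have f14 : Real.log (1 - β - (β - β ^ 2)) = 2 * Real.log (1 - β) := by
    rw [show (1:ℝ) - β - (β - β ^ 2) = (1 - β) ^ 2 by ring, Real.log_pow]; norm_num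
  unfold slyPrefA
  rw [e2, e10, e14, f2, f10, f14, Real.log_one]
  ring

/-- **The overlap prefactor at the product point**: `exp(Pref_A(c*)) = 1/(α²β²(1-α)²(1-β)²)`.
[folklore] -/
theorem exp_slyPrefA_cstar (hα : 0 < α) (hβ : 0 < β) (hαβ : α + β < 1) :
    Real.exp (slyPrefA α β (α ^ 2) (β ^ 2)) = 1 / (α ^ 2 * β ^ 2 * (1 - α) ^ 2 * (1 - β) ^ 2) := by
  have h1 : 0 < 1 - α := by linarith
  have h2 : 0 < 1 - β := by linarith
  rw [slyPrefA_cstar_eq hα hβ hαβ,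
    show -2 * (Real.log α + Real.log β + Real.log (1 - α) + Real.log (1 - β)) =
      -Real.log ((α * β * (1 - α) * (1 - β)) ^ 2) by
        rw [Real.log_pow, Real.log_mul (by positivity) h2.ne', Real.log_mul (by positivity) h1.ne',
          Real.log_mul hα.ne' hβ.ne']; push_cast; ring,
    Real.exp_neg, Real.exp_log (by positivity)]
  field_simp

/-- **The identity behind `τ̃ = τ`, colour part**: `exp(Pref_B(c*)) (1 - ρ²) = κ₃`. [folklore] -/
theorem exp_slyPrefB_mul (hα : 0 < α) (hβ : 0 < β) (hαβ : α + β < 1) :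
    Real.exp (slyPrefB α β (α ^ 2) (β ^ 2) (α * (1 - α - β))) *
        (1 - (α * β / ((1 - α) * (1 - β))) ^ 2) = slyK3 α β := by
  rw [exp_slyPrefB_cstar hα hβ hαβ]
  have h1 : (1 - α) ≠ 0 := by intro h; linarith
  have h2 : (1 - β) ≠ 0 := by intro h; linarith
  have h3 : (1 - α - β) ≠ 0 := by intro h; linarith
  have hα' : α ≠ 0 := hα.ne'
  have hβ' : β ≠ 0 := hβ.ne'
  unfold slyK3
  field_simp
  ring

/-- **The identity behind `τ̃ = τ`, planar part**: `exp(Pref_A(c*)) (1 - (d-1)²ρ²) = (1-ρ²)(AC - B²)`.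
[folklore] -/
theorem exp_slyPrefA_mul (d : ℕ) (hα : 0 < α) (hβ : 0 < β) (hαβ : α + β < 1) :
    Real.exp (slyPrefA α β (α ^ 2) (β ^ 2)) *
        (1 - ((d : ℝ) - 1) ^ 2 * (α * β / ((1 - α) * (1 - β))) ^ 2) =
      (1 - (α * β / ((1 - α) * (1 - β))) ^ 2) * (slySA d α β * slySC d α β - slySB d α β ^ 2) := by
  rw [exp_slyPrefA_cstar hα hβ hαβ, slyS_det hα hβ hαβ]
  have h1 : (1 - α) ≠ 0 := by intro h; linarith
  have h2 : (1 - β) ≠ 0 := by intro h; linarith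
  have h3 : (1 - α - β) ≠ 0 := by intro h; linarith
  have hα' : α ≠ 0 := hα.ne'
  have hβ' : β ≠ 0 := hβ.ne'
  have h4 : (1 - α - β + 2 * α * β) ≠ 0 := by
    have : 0 < 1 - α - β + 2 * α * β := by nlinarith
    exact this.ne'
  set u := 1 - α - β + 2 * α * β with hu
  field_simp
  rw [hu]
  ring

end Prefactors

section PosDef

variable {d : ℕ} {α β : ℝ}

/-- **The planar form is the maximum of `Q_d` over `h₃`**: `S(h₁,h₂) = Q_d(h₁,h₂,ĥ₃)`. [folklore] -/
theorem slyS_eq_slyQ_hhat (hα : 0 < α) (hβ : 0 < β) (hαβ : α + β < 1) (h₁ h₂ : ℝ) :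
    slyQ 0 α β h₁ h₂ 0 + d * slyMB α β h₁ h₂ = slyQ d α β h₁ h₂ (slyHhat α β h₁ h₂) := by
  have hcs := slyQB_complete_square hα hβ hαβ h₁ h₂ (slyHhat α β h₁ h₂)
  rw [sub_self, zero_pow two_ne_zero, mul_zero, sub_zero] at hcs
  unfold slyQB at hcs
  rw [slyQ_eq_zero_add α β d h₁ h₂ (slyHhat α β h₁ h₂), ← hcs,
    slyQ_zero_indep α β h₁ h₂ 0 (slyHhat α β h₁ h₂)]

/-- `S(h₁,h₂) ≥ Q_d(h₁,h₂,0)`. [folklore] -/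
theorem slyQ_plane_le_slyS (hα : 0 < α) (hβ : 0 < β) (hαβ : α + β < 1) (h₁ h₂ : ℝ) :
    slyQ d α β h₁ h₂ 0 ≤ slyQ 0 α β h₁ h₂ 0 + d * slyMB α β h₁ h₂ := by
  have l := slyQB_le_slyMB hα hβ hαβ h₁ h₂ 0
  unfold slyQB at l
  rw [slyQ_eq_zero_add α β d h₁ h₂ 0]
  have hd : (0 : ℝ) ≤ d := Nat.cast_nonneg d
  nlinarith [mul_le_mul_of_nonneg_left l hd]

/-- **Positive definiteness and size of the planar form** from `-H_d ≻ κ`: `C ≥ 2κ`, `A ≥ 2κ`,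
`AC - B² ≥ 2κC`, and `A, C ≤ 2K`, `|B| ≤ 4K` with `K = 3(d+2)/m⁵ + κ`. [folklore] -/
theorem slyS_bounds (hα : 0 < α) (hβ : 0 < β) (hαβ : α + β < 1) {m : ℝ}
    (hm : m = min (min α β) (1 - α - β)) {κ : ℝ} (hκ : 0 < κ)
    (hPD : ∀ h₁ h₂ h₃ : ℝ, slyQ d α β h₁ h₂ h₃ ≤ -κ * (h₁ ^ 2 + h₂ ^ 2 + h₃ ^ 2)) :
    2 * κ ≤ slySC d α β ∧ 2 * κ ≤ slySA d α β ∧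
      2 * κ * slySC d α β ≤ slySA d α β * slySC d α β - slySB d α β ^ 2 ∧
      slySA d α β ≤ 2 * (3 * ((d : ℝ) + 2) / m ^ 5) ∧ slySC d α β ≤ 2 * (3 * ((d : ℝ) + 2) / m ^ 5) ∧
      |slySB d α β| ≤ 4 * (3 * ((d : ℝ) + 2) / m ^ 5) := by
  set A := slySA d α β with hA
  set B := slySB d α β with hB
  set C := slySC d α β with hC
  set K := 3 * ((d : ℝ) + 2) / m ^ 5 with hK
  -- `S(h₁,h₂) ≤ -κ(h₁²+h₂²)` and `S ≥ -K (|h₁|+|h₂|)²`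
  have hS : ∀ h₁ h₂ : ℝ, -(A * h₁ ^ 2 + 2 * B * h₁ * h₂ + C * h₂ ^ 2) / 2 ≤ -κ * (h₁ ^ 2 + h₂ ^ 2) := by
    intro h₁ h₂
    rw [← slyS_eq hα hβ hαβ, slyS_eq_slyQ_hhat hα hβ hαβ]
    have := hPD h₁ h₂ (slyHhat α β h₁ h₂)
    nlinarith [sq_nonneg (slyHhat α β h₁ h₂)]
  have hS' : ∀ h₁ h₂ : ℝ, -(K * (|h₁| + |h₂|) ^ 2) ≤ -(A * h₁ ^ 2 + 2 * B * h₁ * h₂ + C * h₂ ^ 2) / 2 := by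
    intro h₁ h₂
    rw [← slyS_eq hα hβ hαβ]
    have h1 := slyQ_plane_le_slyS (d := d) hα hβ hαβ h₁ h₂
    have h2 := abs_slyQ_plane_le d hα hβ hαβ hm h₁ h₂
    rw [abs_le] at h2
    linarith [h2.1]
  have hm0 : 0 < m := by rw [hm]; exact lt_min (lt_min hα hβ) (by linarith)
  have hK0 : 0 ≤ K := by positivity
  -- `C ≥ 2κ`, `A ≥ 2κ`
  have eC := hS 0 1
  have eA := hS 1 0
  simp only [one_pow, zero_pow two_ne_zero, mul_zero, mul_one, zero_add, add_zero] at eC eA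
  have hCge : 2 * κ ≤ C := by linarith
  have hAge : 2 * κ ≤ A := by linarith
  -- upper bounds
  have uC := hS' 0 1
  have uA := hS' 1 0
  have uP := hS' 1 1
  have uM := hS' 1 (-1)
  have lP := hS 1 1
  have lM := hS 1 (-1)
  simp only [one_pow, zero_pow two_ne_zero, mul_zero, mul_one, zero_add, add_zero, abs_zero,
    abs_one, abs_neg, mul_neg, neg_sq] at uC uA uP uM lP lM
  norm_num at uC uA uP uM lP lM
  have hCle : C ≤ 2 * K := by linarith
  have hAle : A ≤ 2 * K := by linarith
  have hBle : |B| ≤ 4 * K := by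
    rw [abs_le]; constructor <;> nlinarith
  -- determinant: plug `h = (C, -B)`
  have hdet : 2 * κ * C ≤ A * C - B ^ 2 := by
    have e := hS C (-B)
    have hC0 : 0 < C := by linarith
    -- `-(A C² - 2B²C + C B²)/2 = -C(AC - B²)/2 ≤ -κ(C² + B²) ≤ -κ C²`
    have : C * (A * C - B ^ 2) ≥ 2 * κ * (C ^ 2 + B ^ 2) := by nlinarith
    nlinarith [sq_nonneg B]
  exact ⟨hCge, hAge, hdet, hAle, hCle, hBle⟩

end PosDef

section TauEq

variable {d : ℕ} {α β : ℝ}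

/-- `ρ² < 1` on the open simplex. [folklore] -/
theorem slyRho_sq_lt_one (hα : 0 < α) (hβ : 0 < β) (hαβ : α + β < 1) :
    (α * β / ((1 - α) * (1 - β))) ^ 2 < 1 := by
  have h1 : 0 < 1 - α := by linarith
  have h2 : 0 < 1 - β := by linarith
  have hlt : α * β / ((1 - α) * (1 - β)) < 1 := by
    rw [div_lt_one (by positivity)]; nlinarith
  have h0 : 0 ≤ α * β / ((1 - α) * (1 - β)) := by positivity
  nlinarith

/-- **The constant of the Laplace evaluation is `τ`**:
`e^{Pref_A(c*)/2} (e^{Pref_B(c*)/2} κ₃^{-1/2})^d / √(AC - B²) = τ = (1-(d-1)²ρ²)^{-1/2}(1-ρ²)^{-(d-1)/2}`.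
[cite: MosselWeitzWormald2008, Theorem 6.11 and Lemma 7.6 (`E[Z²]/(EZ)² → exp(Σ λ_i δ_i²)`); Sly2010, Lemma 3.5] -/
theorem slyTau_eq_prefactors (hd : 1 ≤ d) (hα : 0 < α) (hβ : 0 < β) (hαβ : α + β < 1)
    (hD : 0 < slySA d α β * slySC d α β - slySB d α β ^ 2) :
    Real.exp (slyPrefA α β (α ^ 2) (β ^ 2) / 2) *
        (Real.exp (slyPrefB α β (α ^ 2) (β ^ 2) (α * (1 - α - β)) / 2) / Real.sqrt (slyK3 α β)) ^ d /
        Real.sqrt (slySA d α β * slySC d α β - slySB d α β ^ 2) = slyTau d α β := by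
  set ρ2 : ℝ := (α * β / ((1 - α) * (1 - β))) ^ 2 with hρ2
  set D := slySA d α β * slySC d α β - slySB d α β ^ 2 with hDdef
  set y : ℝ := 1 - ρ2 with hy
  set x : ℝ := 1 - ((d : ℝ) - 1) ^ 2 * ρ2 with hx
  have hy0 : 0 < y := by rw [hy]; linarith [slyRho_sq_lt_one hα hβ hαβ]
  have hκ3 := slyK3_pos hα hβ hαβ
  have hRA := exp_slyPrefA_mul d hα hβ hαβ
  have hRB := exp_slyPrefB_mul hα hβ hαβ
  rw [← hρ2] at hRA hRB
  rw [← hDdef] at hRA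
  set RA := Real.exp (slyPrefA α β (α ^ 2) (β ^ 2)) with hRAd
  set RB := Real.exp (slyPrefB α β (α ^ 2) (β ^ 2) (α * (1 - α - β))) with hRBd
  have hRA0 : 0 < RA := Real.exp_pos _
  have hRB0 : 0 < RB := Real.exp_pos _
  -- `x > 0` from the identity
  have hx0 : 0 < x := by
    have h1 : RA * x = y * D := by rw [hx, hy]; exact hRA
    have h2 : 0 < y * D := mul_pos hy0 hD
    nlinarith
  -- square roots
  have eA : Real.exp (slyPrefA α β (α ^ 2) (β ^ 2) / 2) = Real.sqrt RA := by
    rw [hRAd, ← Real.exp_half]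
  have eB : Real.exp (slyPrefB α β (α ^ 2) (β ^ 2) (α * (1 - α - β)) / 2) = Real.sqrt RB := by
    rw [hRBd, ← Real.exp_half]
  have hRBy : RB = slyK3 α β / y := by
    rw [hy, eq_div_iff hy0.ne']; exact hRB
  have hRAx : RA = y * D / x := by
    rw [eq_div_iff hx0.ne', hx, hy]; exact hRA
  -- the target in terms of `x, y`
  have hτ : slyTau d α β = (Real.sqrt x)⁻¹ * ((Real.sqrt y)⁻¹) ^ (d - 1) := by
    unfold slyTau
    rw [← hρ2, ← hx, ← hy]
    obtain ⟨k, rfl⟩ : ∃ k, d = k + 1 := ⟨d - 1, by omega⟩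
    simp only [Nat.add_sub_cancel]
    rw [Real.rpow_neg hx0.le, ← Real.sqrt_eq_rpow,
      show -((((k + 1 : ℕ) : ℝ) - 1) / 2) = -((1 / 2 : ℝ) * (k : ℝ)) by push_cast; ring,
      Real.rpow_neg hy0.le, Real.rpow_mul hy0.le, Real.rpow_natCast, ← Real.sqrt_eq_rpow, inv_pow]
  rw [hτ, eA, eB, hRBy, hRAx]
  obtain ⟨k, rfl⟩ : ∃ k, d = k + 1 := ⟨d - 1, by omega⟩
  simp only [Nat.add_sub_cancel]
  have hsy : 0 < Real.sqrt y := Real.sqrt_pos.mpr hy0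
  have hsx : 0 < Real.sqrt x := Real.sqrt_pos.mpr hx0
  have hsD : 0 < Real.sqrt D := Real.sqrt_pos.mpr hD
  have hsK : 0 < Real.sqrt (slyK3 α β) := Real.sqrt_pos.mpr hκ3
  have e1 : Real.sqrt (slyK3 α β / y) / Real.sqrt (slyK3 α β) = (Real.sqrt y)⁻¹ := by
    rw [Real.sqrt_div' _ hy0.le]; field_simp
  have e2 : Real.sqrt (y * D / x) = Real.sqrt y * Real.sqrt D / Real.sqrt x := by
    rw [Real.sqrt_div' _ hx0.le, Real.sqrt_mul hy0.le]
  rw [e1, e2, pow_succ]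
  field_simp

end TauEq

end Literature.Computability.Complexity
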